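import Summits.BirchSwinnertonDyer.Rank1Residual.P2.KrizLiJZeroSetting
import Summits.BirchSwinnertonDyer.Rank1Residual.P2.KrizLiTwoFortyThreeCurve
import Summits.BirchSwinnertonDyer.BirchSwinnertonDyer.Theorems.Rank2ObservatoryConductorCert
import HarnessLib

/-!
# Cell `bsd-print-cf2` (D-0131 (2) PRINT TIER, leaf CornerF @ `p = 2`), typer ty2 — the (★)-CERTIFIED
# Kriz–Li bases `1323a1`, `1323m1` (`j = 0`, good at `2`, `K = ℚ(√−47)`) in the SETTING of Kriz–Li 2019
# Thm 5.1 (2), every kernel-checkable hypothesis DISCHARGED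

HONEST FRAMING. Companion of `P2/KrizLiJZeroSetting.lean` (the generic shape `E_a : y² + y = x³ + a`
and the quadratic field) and of p3's `P2/KrizLiTwoFortyThree*.lean` (the PRINTED base `243a1`, Kriz–Li
2019 §6 Table 1); sequel `P2/KrizLiFortyFiveSixtyThree.lean` (`4563a1`, `4563b1`). The cell's lit seat
(dossier `run/shared/lean/pub/bsd-print-cf2/DOSSIER.md` §14.4, kit job j282459, SageMath; engine of that
seat, NOT a certificate of record, NOT print) found that Assumption (★) of Kriz–Li 2019 Thm 5.1 (2)
(tree `KrizLi2019.thm112_bsdTwo_twist`) also holds at the `j = 0` bases `1323a1 = E₆₀₀` and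
`1323m1 = E₋₂` with `K = ℚ(√−47)` (`d_K = −47`: `2`, `3`, `7` split), both of analytic rank one, good
supersingular at `2` (INERT-GOOD quadrant of crux `InertJZeroOfFacts`, stmt-BirchSwinnertonDyer-20671),
conductor `1323 < 5000` (so the base `BSD(E,2)` is Creutz–Miller / Miller–Stoll BY NAME, tree
`bsdTriple_of_analyticRank_le_one_of_conductor_lt`) and with `c₂ = 1`. This file DISCHARGES IN THE
KERNEL, for the two Cremona models, every hypothesis of Thm 5.1 (2) except (★) itself (which stays the
consumer's DISPLAYED binder — a `2`-adic logarithm of a Heegner point — or a ty3 certificate record):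
global minimality (Kraus certificate), `E(ℚ)[2] = 0` (generic, `twoTorsion_cubicA₃`), `N ∣ 1323 = 3³·7²`
(Ogg) hence `N < 5000`, the EXACT exponent `ord₇ N = 2` (additive at `7`, Silverman *ATAEC* IV.10.2(b))
hence `N = 3ᵏ·7²` and the sign clause `χ_d(−N) = 1` for `d > 0`, `d ≡ 1 (mod 12)`, `7 ∤ d`; a rational
point of infinite order (`1 ≤ rank_ℤ E(ℚ)`, the input that makes `r_an(E) = 1` once Thm 4.3's dichotomy
and Burungale–Flach are granted); the Heegner hypothesis K-GENERICALLY (`(d_K/3) = (d_K/7) = 1`) and at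
`d_K = −47`; the prime support of `2N`; and the decidable form of "`a_ℓ` odd". No named fact is
introduced; nothing is asserted beyond kernel theorems about two explicit curves; the leaf is OPEN AS A
CLASS. Consumer: the base- and K-generic by-name Kriz–Li theorem of prover p3 (cell STATUS
2026-08-27T18:11:38Z), instantiated at these bases with (★) displayed.

References: [KrizLi2019] Thm 5.1 (2) = arXiv:1606.03172 Thm 1.12, Def 4.1, Thm 4.3, §6 Ex. 6.2,
Rem. 6.3; [Cremona1997] Table 1 (1323a1, 1323m1); [SilvermanAEC2009] VII.1 Rem 1.1, VII.3.4, VII.5.1,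
VIII.6.7; [Silverman1994] IV.10.2, IV.10.4, IV.11.1; [Marcus1977] Ch. 2 Thm 1, Ch. 3 Thm 25;
[CreutzMiller2012] Thm 1.1; cell dossier §14.4 (certified (★) rows, minimal models, generators).
-/

noncomputable section

open scoped Classical

open WeierstrassCurve NumberField Literature.NumberTheory.EllipticCurves
  Literature.NumberTheory.EllipticCurves.Rank1Residual
  Literature.NumberTheory.EllipticCurves.ModularForms
  Summit.BirchSwinnertonDyer.Rank1Residual

set_option autoImplicit false

namespace Summit.BirchSwinnertonDyer.Rank1Residual.P2

open Summit.BirchSwinnertonDyer.BirchSwinnertonDyer.Theorems.ConductorBoundOfBadPrimes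
  Literature.NumberTheory.EllipticCurves.Rank1Residual.X11RankOneCertificates IsDedekindDomain

/-! ## §0 Shared: the integer model base-changes to `E_a`; conductors of the shape `3ᵏ · q²` -/

/-- The integer model `[0,0,1,0,a]` base-changes to `E_a`. [folklore] -/
theorem cubicA₃Int_baseChange (a : ℤ) : (cubicA₃Int a).baseChange ℚ = cubicA₃ a := by
  ext <;> simp [cubicA₃Int, cubicA₃, WeierstrassCurve.baseChange, WeierstrassCurve.map]

/-- `c₄` of the integer model is `0`. [folklore] -/
theorem cubicA₃Int_c₄ (a : ℤ) : (cubicA₃Int a).c₄ = 0 := by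
  simp only [cubicA₃Int, WeierstrassCurve.c₄, WeierstrassCurve.b₂, WeierstrassCurve.b₄]
  norm_num

/-- **`f_q(E_a) = 2` at a prime `q ≥ 5` with `q ∣ 4a + 1`** (then `q ∣ Δ = −27(4a+1)²`, `q ∣ c₄ = 0`,
`q¹² ∤ Δ` as soon as `q⁶ ∤ (4a+1)… ` — here from an explicit exact power `qⁿ ∥ Δ`, `1 ≤ n < 12`):
additive reduction at `q` (Silverman VII.5.1(c)) and `f_q = 2` for additive `q ≥ 5` (ATAEC IV.10.2(b),
tree `conductorExponent_eq_two_of_five_le_holds`). [cite: SilvermanATAEC1994, Thm. IV.10.2] [cite: SilvermanAEC2009, VII.5 Prop. 5.1(c)] -/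
theorem factorization_conductorNorm_cubicA₃_eq_two (a : ℤ) [(cubicA₃ a).IsGloballyMinimal] {q : ℕ}
    (hq : q.Prime) (hq5 : 5 ≤ q) {n : ℕ} (hn₁ : 1 ≤ n) (hn12 : n < 12)
    (hΔ : (q : ℤ) ^ n ∣ (cubicA₃Int a).Δ) (hΔ' : ¬ (q : ℤ) ^ (n + 1) ∣ (cubicA₃Int a).Δ) :
    ((cubicA₃ a).conductorNorm ℤ).factorization q = 2 := by
  set v : HeightOneSpectrum ℤ := (Rat.HeightOneSpectrum.primesEquiv (R := ℤ)).symm ⟨q, hq⟩ with hv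
  have hgen : Rat.HeightOneSpectrum.natGenerator v = q :=
    Literature.NumberTheory.EllipticCurves.Rat.natGenerator_primesEquiv_symm _
  haveI : ((cubicA₃Int a).baseChange ℚ).IsElliptic := by rw [cubicA₃Int_baseChange]; infer_instance
  have hadd : ((cubicA₃Int a).baseChange ℚ).HasAdditiveReductionAt v :=
    BirchSwinnertonDyer.Rank2Observatory.RootNumber.hasAdditiveReductionAt_of_dvd (W₀ := cubicA₃Int a) v hn₁
      (by rw [hgen]; exact hΔ) (by rw [hgen]; exact hΔ') (Or.inl hn12) (by rw [cubicA₃Int_c₄]; exact dvd_zero _)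
  rw [cubicA₃Int_baseChange] at hadd
  rw [factorization_conductorNorm_primesEquiv_symm (cubicA₃ a) ⟨q, hq⟩]
  exact conductorExponent_eq_two_of_five_le_holds (cubicA₃ a) v (by rw [hgen]; exact hq5) hadd

/-- Arithmetic: `N ∣ 3ⁱ · qᵉ` and `ord_q N = e` (`q` prime, `e ≥ 1`) force `N = 3ᵏ · qᵉ` for some `k`
(used with `q = 7, 13`, `e = 2` here and with `q = 2`, `e = f₂` for the bases additive at `2`). [folklore] -/
theorem eq_three_pow_mul_pow_of_dvd {N i q e : ℕ} (hq : q.Prime) (he : e ≠ 0) (hN : N ∣ 3 ^ i * q ^ e)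
    (hf : N.factorization q = e) : ∃ k, N = 3 ^ k * q ^ e := by
  have hN0 : N ≠ 0 := by
    rintro rfl; simp at hf; exact he hf.symm
  have hqe : q ^ e ∣ N := by
    rw [← hf]; exact Nat.ordProj_dvd N q
  obtain ⟨M, hM⟩ := hqe
  have hMdvd : M ∣ 3 ^ i := by
    have h : q ^ e * M ∣ q ^ e * 3 ^ i := by rw [← hM, mul_comm]; exact hN
    exact (Nat.mul_dvd_mul_iff_left (pow_pos hq.pos e)).mp h
  obtain ⟨k, -, rfl⟩ := (Nat.dvd_prime_pow Nat.prime_three).mp hMdvd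
  exact ⟨k, by rw [hM, mul_comm]⟩


/-! ## §1 `1323a1 = E₆₀₀ : y² + y = x³ + 600` (`N = 1323 = 3³·7²`; the class of `x³ + y³ = 49` up to `3`-isogeny) -/

/-- **Cremona's `1323a1 = [0,0,1,0,600]`** (`Δ = −27·7^8`; generator `(1617/4, 65019/8)`; rank `1`;
(★) certified at `K = ℚ(√−47)`, cell dossier §14.4 — NOT printed).
[cite: Cremona1997, Table 1 (curve 1323a1)] -/
abbrev curve1323a1 : WeierstrassCurve ℚ := cubicA₃ 600

/-- **`1323a1` is globally minimal** (`|Δ| = 3³·7^8`, exponents `< 12`). [cite: SilvermanAEC2009, VII.1 Remark 1.1] -/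
instance isGloballyMinimal_curve1323a1 : curve1323a1.IsGloballyMinimal :=
  X11b.isGloballyMinimal_of_krausCriterion_support 0 0 1 0 600 [(3, 3, 3), (7, 2, 8)]
    (by intro t ht; simp only [List.mem_cons, List.not_mem_nil, or_false] at ht; rcases ht with rfl | rfl <;> norm_num)
    (by decide +kernel) (by decide +kernel)

/-- **`N(1323a1) ∣ 1323 = 3³·7²`** (Ogg: `f₃ ≤ ord₃ Δ = 3`; `f_7 ≤ 2`). [cite: Silverman1994, IV.10.4 and IV.11.1] -/
theorem conductorNorm_curve1323a1_dvd : curve1323a1.conductorNorm ℤ ∣ 1323 :=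
  conductorNorm_dvd_of_localBounds 0 0 1 0 600 curve1323a1 rfl [(3, 3), (7, 8)]
    (by intro t ht; simp only [List.mem_cons, List.not_mem_nil, or_false] at ht; rcases ht with rfl | rfl <;> norm_num)
    (by decide +kernel) (by norm_num) (by decide +kernel)

/-- `N(1323a1) < 5000` (Creutz–Miller's range). [folklore] -/
theorem conductorNorm_curve1323a1_lt : curve1323a1.conductorNorm ℤ < 5000 :=
  lt_of_le_of_lt (Nat.le_of_dvd (by norm_num) conductorNorm_curve1323a1_dvd) (by norm_num)

/-- `N(1323a1) ≠ 0`. [folklore] -/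
instance neZero_conductorNorm_curve1323a1 : NeZero (curve1323a1.conductorNorm ℤ) :=
  ⟨(curve1323a1.conductorNorm_pos_holds).ne'⟩

/-- **`ord_7 N(1323a1) = 2`** (additive at `7`: `7^8 ∥ Δ`, `c₄ = 0`). [cite: SilvermanATAEC1994, Thm. IV.10.2] -/
theorem factorization_conductorNorm_curve1323a1_q : (curve1323a1.conductorNorm ℤ).factorization 7 = 2 :=
  factorization_conductorNorm_cubicA₃_eq_two 600 (by norm_num) (by norm_num) (n := 8) (by norm_num) (by norm_num)
    (by rw [cubicA₃Int_Δ]; norm_num) (by rw [cubicA₃Int_Δ]; norm_num)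

/-- **`N(1323a1) = 3ᵏ · 7²`** for some `k` (Cremona: `k = 3`, not needed). [cite: Cremona1997, Table 1 (1323a1)] -/
theorem conductorNorm_curve1323a1_eq : ∃ k, curve1323a1.conductorNorm ℤ = 3 ^ k * 7 ^ 2 :=
  eq_three_pow_mul_pow_of_dvd (i := 3) (by norm_num) (by norm_num) (by simpa using conductorNorm_curve1323a1_dvd)
    factorization_conductorNorm_curve1323a1_q

/-- A prime `ℓ ∉ {2, 3, 7}` does not divide `2N(1323a1)`. [folklore] -/
theorem not_dvd_two_mul_conductorNorm_curve1323a1 {ℓ : ℕ} (hℓ : ℓ.Prime) (h2 : ℓ ≠ 2) (h3 : ℓ ≠ 3)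
    (hq : ℓ ≠ 7) : ¬ ℓ ∣ 2 * curve1323a1.conductorNorm ℤ := by
  intro h
  have h' : ℓ ∣ 2 * (3 ^ 3 * 7 ^ 2) := h.trans (mul_dvd_mul_left 2 (by simpa using conductorNorm_curve1323a1_dvd))
  rcases (Nat.Prime.dvd_mul hℓ).mp h' with h | h
  · exact h2 ((Nat.prime_dvd_prime_iff_eq hℓ Nat.prime_two).mp h)
  · rcases (Nat.Prime.dvd_mul hℓ).mp h with h | h
    · exact h3 ((Nat.prime_dvd_prime_iff_eq hℓ Nat.prime_three).mp (hℓ.dvd_of_dvd_pow h))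
    · exact hq ((Nat.prime_dvd_prime_iff_eq hℓ (by norm_num)).mp (hℓ.dvd_of_dvd_pow h))

/-- **`1 ≤ rank_ℤ 1323a1(ℚ)` IN THE KERNEL**: `2·(1617/4, 65019/8)` has `x = 2847189345 / 28174864` with
the odd prime `1327 ∣ 28174864`. [cite: SilvermanAEC2009, VII.3.4 and Thm. VIII.6.7] [cite: Cremona1997, Table 1 (1323a1: r = 1)] -/
theorem one_le_mordellWeilRank_curve1323a1 : 1 ≤ curve1323a1.mordellWeilRank := by
  haveI : Fact (Nat.Prime 1327) := ⟨by norm_num⟩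
  exact one_le_mordellWeilRank_of_dvd_den curve1323a1 1327 (by norm_num) (x := 2847189345 / 28174864)
    (y := 151892750011313 / 149552178112)
    (WeierstrassCurve.Affine.equation_iff_nonsingular.mp (by
      rw [WeierstrassCurve.Affine.equation_iff]; norm_num [cubicA₃]))
    (by norm_num)

/-- **The Heegner hypothesis for `N(1323a1)` in ANY quadratic `K` with `(d_K/3) = (d_K/7) = 1`** (the
primes of `N ∣ 3³·7²` split in `K`). [cite: KrizLi2019, Thm. 5.1 hypothesis "K satisfies the Heegner hypothesis for N"] -/
theorem satisfiesHeegnerHypothesis_curve1323a1 {K : Type} [Field K] [NumberField K]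
    (h2 : Module.finrank ℚ K = 2) (h3 : jacobiSym (NumberField.discr K) 3 = 1)
    (hq : jacobiSym (NumberField.discr K) 7 = 1) : SatisfiesHeegnerHypothesis (curve1323a1.conductorNorm ℤ) K := by
  refine satisfiesHeegnerHypothesis_of_dvd h2 conductorNorm_curve1323a1_dvd (fun q hq' hqB _ => ?_)
    (fun h => absurd h (by norm_num))
  have h' : q ∣ 3 ^ 3 * 7 ^ 2 := by simpa using hqB
  rcases (Nat.Prime.dvd_mul hq').mp h' with h | h
  · rw [(Nat.prime_dvd_prime_iff_eq hq' Nat.prime_three).mp (hq'.dvd_of_dvd_pow h)]; exact h3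
  · rw [(Nat.prime_dvd_prime_iff_eq hq' (by norm_num)).mp (hq'.dvd_of_dvd_pow h)]; exact hq

/-- **`a_ℓ(1323a1)` odd `⟺` an even number of cube roots of `-38416 = −16·2401` in `𝔽_ℓ`** (`ℓ ∉ {2,3,7}`).
[cite: KrizLi2019, Def. 4.1 ("Frob_ℓ of order 3", a_ℓ odd)] -/
theorem odd_frobeniusTrace_curve1323a1_iff {ℓ : ℕ} [NeZero ℓ] (hℓ : ℓ.Prime) (h2 : ℓ ≠ 2) (h3 : ℓ ≠ 3)
    (hq : ℓ ≠ 7) : Odd (curve1323a1.frobeniusTrace ℓ) ↔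
      Even ((Finset.univ.filter fun x : ZMod ℓ => x ^ 3 = -38416).card) := by
  have ha : ¬ (ℓ : ℤ) ∣ 4 * 600 + 1 := by
    intro h
    have h' : (ℓ : ℤ) ∣ 7 ^ 4 := by norm_num at h ⊢; exact h
    exact hq ((Nat.prime_dvd_prime_iff_eq hℓ (by norm_num)).mp
      (Int.natCast_dvd_natCast.mp (by exact_mod_cast (Nat.prime_iff_prime_int.mp hℓ).dvd_of_dvd_pow h')))
  have e : (-(16 * (4 * ((600 : ℤ) : ZMod ℓ) + 1)) : ZMod ℓ) = -38416 := by push_cast; norm_num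
  rw [odd_frobeniusTrace_cubicA₃_iff 600 hℓ h2 h3 ha, e]

/-- **The sign clause `χ_d(−N) = 1` for `1323a1`** for positive `d ≡ 1 (mod 12)` prime to `7`
(`N = 3ᵏ·7²`). [cite: KrizLi2019, Thm. 5.1 (2) condition "χ_d(−N) = 1"] -/
theorem sign_mul_jacobiSym_conductorNorm_curve1323a1 {d : ℤ} (hd0 : 0 < d) (hd12 : d % 12 = 1)
    (hq : ¬ (7 : ℤ) ∣ d) : Int.sign d * jacobiSym (curve1323a1.conductorNorm ℤ) d.natAbs = 1 := by
  obtain ⟨k, hk⟩ := conductorNorm_curve1323a1_eq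
  refine sign_mul_jacobiSym_eq_one_of_eq_pow_mul_sq hk hd0 hd12 ?_
  exact (Nat.Prime.coprime_iff_not_dvd (by norm_num : Nat.Prime 7)).mpr
    (fun h => hq (by exact_mod_cast Int.ofNat_dvd_left.mpr h))

/-! ## §2 `1323m1 = E₋₂ : y² + y = x³ − 2` (`N = 1323 = 3³·7²`) -/

/-- **Cremona's `1323m1 = [0,0,1,0,-2]`** (`Δ = −27·7^2`; generator `(2, 2)`; rank `1`;
(★) certified at `K = ℚ(√−47)`, cell dossier §14.4 — NOT printed).
[cite: Cremona1997, Table 1 (curve 1323m1)] -/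
abbrev curve1323m1 : WeierstrassCurve ℚ := cubicA₃ (-2)

/-- **`1323m1` is globally minimal** (`|Δ| = 3³·7^2`, exponents `< 12`). [cite: SilvermanAEC2009, VII.1 Remark 1.1] -/
instance isGloballyMinimal_curve1323m1 : curve1323m1.IsGloballyMinimal :=
  X11b.isGloballyMinimal_of_krausCriterion_support 0 0 1 0 (-2) [(3, 3, 3), (7, 2, 2)]
    (by intro t ht; simp only [List.mem_cons, List.not_mem_nil, or_false] at ht; rcases ht with rfl | rfl <;> norm_num)
    (by decide +kernel) (by decide +kernel)

/-- **`N(1323m1) ∣ 1323 = 3³·7²`** (Ogg: `f₃ ≤ ord₃ Δ = 3`; `f_7 ≤ 2`). [cite: Silverman1994, IV.10.4 and IV.11.1] -/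
theorem conductorNorm_curve1323m1_dvd : curve1323m1.conductorNorm ℤ ∣ 1323 :=
  conductorNorm_dvd_of_localBounds 0 0 1 0 (-2) curve1323m1 rfl [(3, 3), (7, 2)]
    (by intro t ht; simp only [List.mem_cons, List.not_mem_nil, or_false] at ht; rcases ht with rfl | rfl <;> norm_num)
    (by decide +kernel) (by norm_num) (by decide +kernel)

/-- `N(1323m1) < 5000` (Creutz–Miller's range). [folklore] -/
theorem conductorNorm_curve1323m1_lt : curve1323m1.conductorNorm ℤ < 5000 :=
  lt_of_le_of_lt (Nat.le_of_dvd (by norm_num) conductorNorm_curve1323m1_dvd) (by norm_num)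

/-- `N(1323m1) ≠ 0`. [folklore] -/
instance neZero_conductorNorm_curve1323m1 : NeZero (curve1323m1.conductorNorm ℤ) :=
  ⟨(curve1323m1.conductorNorm_pos_holds).ne'⟩

/-- **`ord_7 N(1323m1) = 2`** (additive at `7`: `7^2 ∥ Δ`, `c₄ = 0`). [cite: SilvermanATAEC1994, Thm. IV.10.2] -/
theorem factorization_conductorNorm_curve1323m1_q : (curve1323m1.conductorNorm ℤ).factorization 7 = 2 :=
  factorization_conductorNorm_cubicA₃_eq_two (-2) (by norm_num) (by norm_num) (n := 2) (by norm_num) (by norm_num)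
    (by rw [cubicA₃Int_Δ]; norm_num) (by rw [cubicA₃Int_Δ]; norm_num)

/-- **`N(1323m1) = 3ᵏ · 7²`** for some `k` (Cremona: `k = 3`, not needed). [cite: Cremona1997, Table 1 (1323m1)] -/
theorem conductorNorm_curve1323m1_eq : ∃ k, curve1323m1.conductorNorm ℤ = 3 ^ k * 7 ^ 2 :=
  eq_three_pow_mul_pow_of_dvd (i := 3) (by norm_num) (by norm_num) (by simpa using conductorNorm_curve1323m1_dvd)
    factorization_conductorNorm_curve1323m1_q

/-- A prime `ℓ ∉ {2, 3, 7}` does not divide `2N(1323m1)`. [folklore] -/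
theorem not_dvd_two_mul_conductorNorm_curve1323m1 {ℓ : ℕ} (hℓ : ℓ.Prime) (h2 : ℓ ≠ 2) (h3 : ℓ ≠ 3)
    (hq : ℓ ≠ 7) : ¬ ℓ ∣ 2 * curve1323m1.conductorNorm ℤ := by
  intro h
  have h' : ℓ ∣ 2 * (3 ^ 3 * 7 ^ 2) := h.trans (mul_dvd_mul_left 2 (by simpa using conductorNorm_curve1323m1_dvd))
  rcases (Nat.Prime.dvd_mul hℓ).mp h' with h | h
  · exact h2 ((Nat.prime_dvd_prime_iff_eq hℓ Nat.prime_two).mp h)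
  · rcases (Nat.Prime.dvd_mul hℓ).mp h with h | h
    · exact h3 ((Nat.prime_dvd_prime_iff_eq hℓ Nat.prime_three).mp (hℓ.dvd_of_dvd_pow h))
    · exact hq ((Nat.prime_dvd_prime_iff_eq hℓ (by norm_num)).mp (hℓ.dvd_of_dvd_pow h))

/-- **`1 ≤ rank_ℤ 1323m1(ℚ)` IN THE KERNEL**: `2·(2, 2)` has `x = 44 / 25` with
the odd prime `5 ∣ 25`. [cite: SilvermanAEC2009, VII.3.4 and Thm. VIII.6.7] [cite: Cremona1997, Table 1 (1323m1: r = 1)] -/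
theorem one_le_mordellWeilRank_curve1323m1 : 1 ≤ curve1323m1.mordellWeilRank := by
  haveI : Fact (Nat.Prime 5) := ⟨by norm_num⟩
  exact one_le_mordellWeilRank_of_dvd_den curve1323m1 5 (by norm_num) (x := 44 / 25)
    (y := -303 / 125)
    (WeierstrassCurve.Affine.equation_iff_nonsingular.mp (by
      rw [WeierstrassCurve.Affine.equation_iff]; norm_num [cubicA₃]))
    (by norm_num)

/-- **The Heegner hypothesis for `N(1323m1)` in ANY quadratic `K` with `(d_K/3) = (d_K/7) = 1`** (the
primes of `N ∣ 3³·7²` split in `K`). [cite: KrizLi2019, Thm. 5.1 hypothesis "K satisfies the Heegner hypothesis for N"] -/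
theorem satisfiesHeegnerHypothesis_curve1323m1 {K : Type} [Field K] [NumberField K]
    (h2 : Module.finrank ℚ K = 2) (h3 : jacobiSym (NumberField.discr K) 3 = 1)
    (hq : jacobiSym (NumberField.discr K) 7 = 1) : SatisfiesHeegnerHypothesis (curve1323m1.conductorNorm ℤ) K := by
  refine satisfiesHeegnerHypothesis_of_dvd h2 conductorNorm_curve1323m1_dvd (fun q hq' hqB _ => ?_)
    (fun h => absurd h (by norm_num))
  have h' : q ∣ 3 ^ 3 * 7 ^ 2 := by simpa using hqB
  rcases (Nat.Prime.dvd_mul hq').mp h' with h | h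
  · rw [(Nat.prime_dvd_prime_iff_eq hq' Nat.prime_three).mp (hq'.dvd_of_dvd_pow h)]; exact h3
  · rw [(Nat.prime_dvd_prime_iff_eq hq' (by norm_num)).mp (hq'.dvd_of_dvd_pow h)]; exact hq

/-- **`a_ℓ(1323m1)` odd `⟺` an even number of cube roots of `112 = −16·-7` in `𝔽_ℓ`** (`ℓ ∉ {2,3,7}`).
[cite: KrizLi2019, Def. 4.1 ("Frob_ℓ of order 3", a_ℓ odd)] -/
theorem odd_frobeniusTrace_curve1323m1_iff {ℓ : ℕ} [NeZero ℓ] (hℓ : ℓ.Prime) (h2 : ℓ ≠ 2) (h3 : ℓ ≠ 3)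
    (hq : ℓ ≠ 7) : Odd (curve1323m1.frobeniusTrace ℓ) ↔
      Even ((Finset.univ.filter fun x : ZMod ℓ => x ^ 3 = 112).card) := by
  have ha : ¬ (ℓ : ℤ) ∣ 4 * (-2) + 1 := by
    intro h
    have h' : (ℓ : ℤ) ∣ 7 ^ 1 := by norm_num at h ⊢; exact h
    exact hq ((Nat.prime_dvd_prime_iff_eq hℓ (by norm_num)).mp
      (Int.natCast_dvd_natCast.mp (by exact_mod_cast (Nat.prime_iff_prime_int.mp hℓ).dvd_of_dvd_pow h')))
  have e : (-(16 * (4 * ((-2 : ℤ) : ZMod ℓ) + 1)) : ZMod ℓ) = 112 := by push_cast; norm_num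
  rw [odd_frobeniusTrace_cubicA₃_iff (-2) hℓ h2 h3 ha, e]

/-- **The sign clause `χ_d(−N) = 1` for `1323m1`** for positive `d ≡ 1 (mod 12)` prime to `7`
(`N = 3ᵏ·7²`). [cite: KrizLi2019, Thm. 5.1 (2) condition "χ_d(−N) = 1"] -/
theorem sign_mul_jacobiSym_conductorNorm_curve1323m1 {d : ℤ} (hd0 : 0 < d) (hd12 : d % 12 = 1)
    (hq : ¬ (7 : ℤ) ∣ d) : Int.sign d * jacobiSym (curve1323m1.conductorNorm ℤ) d.natAbs = 1 := by
  obtain ⟨k, hk⟩ := conductorNorm_curve1323m1_eq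
  refine sign_mul_jacobiSym_eq_one_of_eq_pow_mul_sq hk hd0 hd12 ?_
  exact (Nat.Prime.coprime_iff_not_dvd (by norm_num : Nat.Prime 7)).mpr
    (fun h => hq (by exact_mod_cast Int.ofNat_dvd_left.mpr h))

/-! ## §K The certified Heegner field `ℚ(√−47)` (for `1323a1`, `1323m1`) -/

/-- `−47 < 0` (the `Fact` making `sqrtField (−47)` a field). [folklore] -/
instance fact_neg_fortySeven_lt_zero : Fact ((-47 : ℤ) < 0) := ⟨by norm_num⟩

/-- **The tree's `ℚ(√−47) = sqrtField (−47)` is imaginary quadratic with `d_K = −47`.** [cite: Marcus1977, Ch. 2 Thm. 1] -/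
theorem isImaginaryQuadratic_and_discr_sqrtField_neg_fortySeven :
    IsImaginaryQuadratic (sqrtField (-47)) ∧ NumberField.discr (sqrtField (-47)) = -47 :=
  isImaginaryQuadratic_and_discr_of_sq_eq_neg_prime (sqrtField.finrank_eq_two (-47))
    (p := 47) (by norm_num) (by norm_num) (x := sqrtField.r (-47)) (by rw [sqrtField.r_sq']; push_cast; ring)

/-- **`2` splits in any quadratic `K` with `d_K = −47`** (`−47 ≡ 1 (mod 8)`) — the first half of (★).
[cite: Marcus1977, Ch. 3 Thm. 25] -/
theorem ncard_primesOver_two_eq_two_of_discr_eq_neg_fortySeven {K : Type} [Field K] [NumberField K]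
    (h2 : Module.finrank ℚ K = 2) (hdK : NumberField.discr K = -47) :
    ((Ideal.span {(2 : ℤ)}).primesOver (𝓞 K)).ncard = 2 :=
  ncard_primesOver_two_eq_two_of_discr h2 (by rw [hdK]; decide)

/-- **Heegner hypothesis for `(1323a1, K)`, `d_K = −47`**: `(−47/3) = (−47/7) = 1`.
[cite: KrizLi2019, Thm. 5.1 hypothesis "K satisfies the Heegner hypothesis for N"] [cite: Marcus1977, Ch. 3 Thm. 25] -/
theorem satisfiesHeegnerHypothesis_curve1323a1_of_discr_eq {K : Type} [Field K] [NumberField K]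
    (h2 : Module.finrank ℚ K = 2) (hdK : NumberField.discr K = -47) :
    SatisfiesHeegnerHypothesis (curve1323a1.conductorNorm ℤ) K :=
  satisfiesHeegnerHypothesis_curve1323a1 h2 (by rw [hdK]; norm_num) (by rw [hdK]; norm_num)

/-- **Heegner hypothesis for `(1323m1, K)`, `d_K = −47`.** [cite: KrizLi2019, Thm. 5.1 hypothesis "K satisfies the Heegner hypothesis for N"] -/
theorem satisfiesHeegnerHypothesis_curve1323m1_of_discr_eq {K : Type} [Field K] [NumberField K]
    (h2 : Module.finrank ℚ K = 2) (hdK : NumberField.discr K = -47) :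
    SatisfiesHeegnerHypothesis (curve1323m1.conductorNorm ℤ) K :=
  satisfiesHeegnerHypothesis_curve1323m1 h2 (by rw [hdK]; norm_num) (by rw [hdK]; norm_num)

end Summit.BirchSwinnertonDyer.Rank1Residual.P2
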